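import Summits.SmoothPoincare4.SmoothPoincare4.Theorems.ConvexBisectionAcyclicBisectionExistsStabNaturalReduction
import Literature.Geometry.Symplectic.SteinBoundaryContact
import HarnessLib

/-!
# N3 (`stub_STgeo`) ▸ N3-nat: THE STABILISATION DATA — interface vocabulary of the five N3d pieces,
# its angle/region bookkeeping, and N3-nat ⟸ pieces (kernel-checked composition)
(wave 7, brick H6-1 of stub `stub_STgeo` = node N3 of NF4 `stub_modelsOnFibred_of_reach`, line
`modp-braid-orbits`, crux `ConvexBisection.AcyclicBisectionExists`, item stmt-SmoothPoincare4-10508;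
registered sub-goal `helper_node_STnat_of_pieces`; design file `work/design/N3_Stabilisation_Design.lean`
of worker G5, wave 6, whose §2–§4 this file puts into the tree VERBATIM so that the five pieces
N3d-0 … N3d-4/5/6 can be registered against landed names.)

The N3 design proves the registered rebuild statement `stub_STgeo` from a MODEL-level natural front
stabilisation (ST-nat) and N1 (`…StabNaturalReduction.lean`, p166176), and (ST-nat) from five
geometric pieces which share the vocabulary landed here:

* §0 `natWord g c l = (a,+)(a,−)(b,+)(b,−) ++ embed l`, `a = newE g + embed g c`, `b = newF g`;
* §1 `blockSector n` (the open sector of directions containing the four block directions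
  `pageDir (n+4) i`, `i < 4`, and missing the old directions `pageDir (n+4) (k+4)`, `k < n`),
  `modelRegion g n δ₀ ε₁` (collar of depth `δ₀` over binding tube ∪ block sector), `crossVec u s`
  (the model arc of `∂D⁴` crossing the belt sphere of the model 1-handle), with their bookkeeping:
  `pageDir_mem_blockSector`, `pageDir_add_four_not_mem_blockSector`, `isOpen_blockSector`,
  `isOpen_modelRegion`, `not_mem_modelRegion`, `norm_crossVec`, `lamSq_crossVec`, …;
* §2 the interfaces `StabBaseData g n c` (N3d-1: fibred 1-handle presentation of `Base (g+1)` over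
  `Base g` + block curves and maps), `NormalisedDatum M g l S` (N3d-0), `TwoSidedStabModel M g l S`
  (N3d-3) — VERBATIM the design's;
* §3 `node_STnat_of_pieces` (registered `helper_node_STnat_of_pieces`): (ST-nat) with the natural word
  from the five pieces entered as their closed ∀-statements, and `stgeo_of_pieces_of_M2geo`: the
  registered text of `stub_STgeo` from the five pieces and `stub_M2geo` (through p166176).

References: J. B. Etnyre, T. Fuller, IMRN 2006, §2 p. 5 [EtnyreFuller2006]; R. İ. Baykur, AGT 6
(2006), Lemma 1, §5 p. 13 [Baykur2006]; J. Milnor, Ann. of Math. Studies 61 (1968), §9 [Milnor1968];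
A. A. Kosinski, *Differential Manifolds* (1993), VI §6–7 [Kosinski1993].
-/

noncomputable section

-- the prescribed namespace `Summit.<P>.<Sub>.…` duplicates `SmoothPoincare4` (P = Sub)
set_option linter.dupNamespace false

open scoped Manifold ContDiff Topology Real
open Set Function

namespace Summit.SmoothPoincare4.SmoothPoincare4.Theorems.AcyclicBisectionExists.ModpBraidOrbits

open Literature.GroupTheory.CombinatorialGroupTheory.SignedHurwitz
open Literature.Topology.FourManifolds Literature.Topology.FourManifolds.LefschetzBase
open Literature.Topology.FourManifolds.HandleAttachingMap
open Literature.Geometry.Symplectic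
/-! ## §0 The natural stabilised word -/

/-- **The NATURAL stabilised word** `(a,+)(a,−)(b,+)(b,−) ++ embed l`, `a = newE g + embed g c`,
`b = newF g`: what the two-sided Etnyre–Fuller stabilisation followed by trading produces (each
traded dual lands in the page adjacent to its partner).  Two signed Hurwitz moves from
`stabBlock g c ++ embed l` (`helper_hurwitzSteps_natBlock_stabBlock`, landed p165085). [folklore] -/
def natWord (g : ℕ) (c : Fin g ⊕ Fin g → ℤ) (l : IntWord g) : IntWord (g + 1) :=
  (newE g + embed g c, true) :: (newE g + embed g c, false) :: (newF g, true) :: (newF g, false) ::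
    mapWord (embed g) l

/-- The natural word has `n + 4` letters. [folklore] -/
theorem length_natWord (g : ℕ) (c : Fin g ⊕ Fin g → ℤ) (l : IntWord g) :
    (natWord g c l).length = l.length + 4 := by
  simp [natWord, length_mapWord]

/-! ## §1 The block sector of directions, the model region, the model crossing arc -/

/-- **The block sector of directions** for a word of length `n` stabilised to length `n + 4`: the open
sector of `ℂ ∖ 0` of arguments `2πt/(n+4)`, `t ∈ (−17/4, 1/4)`, which contains the four block
directions `pageDir (n+4) i = e^{−2πi(i+½)/(n+4)}`, `i < 4` (`t = −i − ½`) and stays at angular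
distance `π/(2(n+4))` from the first and last old directions `pageDir (n+4) 4`, `pageDir (n+4) (n+3)`
(`t = −9/2`, `t ≡ 1/2`). [folklore] -/
def blockSector (n : ℕ) : Set ℂ :=
  {z | ∃ r t : ℝ, 0 < r ∧ t ∈ Ioo (-(17 / 4 : ℝ)) (1 / 4) ∧
    z = (r : ℂ) * Complex.exp ((2 * π * t / ((n + 4 : ℕ) : ℝ) : ℝ) * Complex.I)}

/-- **The model region** of the old cap / old base `Base g` inside which everything new happens: the
collar of depth `δ₀` (in the defining function `rho`) over the thickened binding tube `‖x‖² > 4 − ε₁`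
(the closed binding tube `‖x‖ ≥ 2` of `∂Base g` is where the feet `J × D²` of the two 1-handles sit —
they are LONG in the `w`-direction, meeting every page, as the bands of the new page must; all flat
pages have `‖x‖² < 4`, and the old attaching circles are first pushed into `‖x‖² < 4 − ε₁`, N3d-0) and
over the block sector of directions (where the block 2-handles attach).  The cancellation
diffeomorphism of N3d-2 is the identity off it. [folklore] -/
def modelRegion (g n : ℕ) (δ₀ ε₁ : ℝ) : Set (Base g) :=
  {p | 1 / 4 - δ₀ < rho g p.1 ∧ (4 - ε₁ < ‖cx p.1‖ ^ 2 ∨ w g p.1 ∈ blockSector n)}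

/-- The model arc `s ↦ (sin s, cos s · u)` of the boundary sphere `∂D⁴` crossing the belt sphere
`{x_λ = 0, ‖x‖ = 1}` of the model 1-handle `D¹ × D³` (`x_λ` = coordinate `0`) transversally at
`s = 0` in the unit direction `u ∈ S² ⊂ ℝ³`. [folklore] -/
def crossVec (u : EuclideanSpace ℝ (Fin 3)) (s : ℝ) : EuclideanSpace ℝ (Fin 4) :=
  WithLp.toLp 2 ![Real.sin s, Real.cos s * u 0, Real.cos s * u 1, Real.cos s * u 2]

/-! ## §2 INTERFACES of the pieces of N3-nat (VERBATIM the design's) -/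

/-- **N3d-1 interface: THE STABILISED BASE DATA for `(g, n, c)`** — a FIBRED 1-HANDLE PRESENTATION
`E` of `Base (g+1)` over `Base g` (two index-1 Kosinski attaching maps `q1 i : T¹ → Base g` with ranges in
the binding part of the model region, and multi-attachment data `E` on the manifold `Base (g+1)` itself)
which preserves `w` on the nose, sends flat pages into flat pages, acts as `embed g` on shadows of page
loops (= node N3b of the NF4 design, now a clause) and transports page twistings of framed embedded
page curves; together with the TWO BLOCK CURVES `A` (class `a = newE g + embed g c`, flat page of
direction `pageDir (n+4) 0`, crossing the belt sphere of the 1-handle `0` exactly once, in model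
position, and missing that of the 1-handle `1`) and `B` (class `b = newF g`, page `pageDir (n+4) 2`,
crossing the belt sphere of `1` once, missing that of `0`), and their LEFSCHETZ ATTACHING MAPS
`qA`, `qB` (attaching circle `A` resp. `B`, page twisting `−1`, disjoint ranges inside the block part
of the model region of `Base (g+1)`).  Milnor 1968 §9 (the fibre of `x^{2g+1}` inside that of
`x^{2g+3}`); Etnyre–Fuller 2006 §2 (stabilisation = 1-handle on the page + vanishing cycle through it
once); Baykur 2006 Lemma 1 (`a = e + c`, `b = f`). [cite: EtnyreFuller2006, §2] -/
structure StabBaseData (g n : ℕ) (c : Fin g ⊕ Fin g → ℤ) where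
  /-- the two 1-handle attaching maps on the old base -/
  q1 : Fin 2 → HandleAttachingMap 3 1 (Base g)
  /-- `Base (g+1)` IS `Base g` with these two 1-handles attached -/
  E : MultiAttachmentData q1 (𝓡∂ 4) (Base (g + 1))
  /-- the block curve of class `a = newE g + embed g c` -/
  A : Metric.sphere (0 : EuclideanSpace ℝ (Fin 2)) 1 → Base (g + 1)
  /-- the block curve of class `b = newF g` -/
  B : Metric.sphere (0 : EuclideanSpace ℝ (Fin 2)) 1 → Base (g + 1)
  /-- the Lefschetz attaching map along `A` -/
  qA : HandleAttachingMap 3 2 (Base (g + 1))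
  /-- the Lefschetz attaching map along `B` -/
  qB : HandleAttachingMap 3 2 (Base (g + 1))
  /-- the depth of the model collar -/
  δ₀ : ℝ
  hδ₀ : 0 < δ₀
  /-- the thickness of the binding part of the model region -/
  ε₁ : ℝ
  hε₁ : 0 < ε₁ ∧ ε₁ ≤ 1 / 2
  /-- the 1-handle attaching maps (Kosinski tubes around the feet `J_i × D²`, attaching 0-spheres on
  the binding) have ranges in the binding part of the model region; `E` is NOT fibred there -/
  range_q1 : ∀ (i : Fin 2) (y : ↥(handleTube 3 1)),
    (q1 i).toFun y ∈ modelRegion g n δ₀ ε₁ ∧ 4 - ε₁ < ‖cx ((q1 i).toFun y).1‖ ^ 2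
  /-- flat pages miss the two attaching 0-spheres -/
  page_mem : ∀ (d : ℂ), ‖d‖ = 1 → ∀ p ∈ page g d, p ∈ coresComplement q1
  /-- `E` is FIBRED off the 1-handle ranges: `w ∘ E.jA = w` there (it cannot be fibred near the feet:
  a new page is the image of the old page off the feet plus two bands) -/
  fibred : ∀ a : ↥(coresComplement q1), (∀ i y, (q1 i).toFun y ≠ (a : Base g)) →
    w (g + 1) (E.jA a).1 = w g (a : Base g).1
  /-- flat page points off the 1-handle ranges go INTO the flat page of the same direction -/
  flat : ∀ (d : ℂ), ‖d‖ = 1 → ∀ (a : ↥(coresComplement q1)), (∀ i y, (q1 i).toFun y ≠ (a : Base g)) →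
    (a : Base g) ∈ page g d → E.jA a ∈ page (g + 1) d
  /-- only points of the old model region are taken into the new model region (depth and binding
  compatibility of `E`; with `fibred` this keeps the old handles, kept off the old model region by
  N3d-0, off the new one, and puts the support of the cancellation of N3d-2 over the old model region) -/
  model_pullback : ∀ a : ↥(coresComplement q1), E.jA a ∈ modelRegion (g + 1) n δ₀ ε₁ →
    (a : Base g) ∈ modelRegion g n δ₀ ε₁
  /-- N3b: `E` acts as `embed g` on shadows of page loops -/
  shadow_embed : ∀ (d : ℂ) (hd : ‖d‖ = 1)
    (K : Metric.sphere (0 : EuclideanSpace ℝ (Fin 2)) 1 → Base g) (hK : Continuous K)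
      (hKd : ∀ θ, K θ ∈ page g d),
      ∃ hK' : Continuous fun θ => E.jA ⟨K θ, page_mem d hd (K θ) (hKd θ)⟩,
        shadow (g + 1) (fun θ => E.jA ⟨K θ, page_mem d hd (K θ) (hKd θ)⟩) hK' =
          embed g (shadow g K hK)
  /-- page twistings of framed embedded page curves off the 1-handle ranges are transported -/
  twisting_transport : ∀ (d : ℂ) (hd : ‖d‖ = 1)
    (K : Metric.sphere (0 : EuclideanSpace ℝ (Fin 2)) 1 → Base g) (ν : Metric.sphere (0 : EuclideanSpace ℝ (Fin 2)) 1 → EuclideanSpace ℝ (Fin 4)),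
      Manifold.IsSmoothEmbedding (𝓡 1) (𝓡∂ 4) ∞ K → (hKd : ∀ θ, K θ ∈ page g d) →
      (∀ θ i y, (q1 i).toFun y ≠ K θ) → IsKnotFraming K ν →
      pageTwisting (g + 1) (fun θ => E.jA ⟨K θ, page_mem d hd (K θ) (hKd θ)⟩)
          (fun θ => mfderiv (𝓡∂ 4) (𝓡∂ 4) E.jA ⟨K θ, page_mem d hd (K θ) (hKd θ)⟩ (ν θ)) =
        pageTwisting g K ν
  /-- `A` is a smoothly embedded curve in the flat page of direction `pageDir (n+4) 0` … -/
  A_emb : Manifold.IsSmoothEmbedding (𝓡 1) (𝓡∂ 4) ∞ A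
  A_page : ∀ θ, A θ ∈ page (g + 1) (pageDir (n + 4) 0)
  /-- … of class `a` … -/
  A_shadow : shadow (g + 1) A A_emb.isEmbedding.continuous = newE g + embed g c
  /-- … crossing the belt sphere of 1-handle `0` exactly once, in model position, and missing that of `1` -/
  A_cross : ∃ (t₀ : ℝ) (u : EuclideanSpace ℝ (Fin 3)) (ε : ℝ), ‖u‖ = 1 ∧ 0 < ε ∧
    (∀ s ∈ Ioo (-ε) ε, ∃ b : ↥(beltPiece 3 1), (b.1.1 : EuclideanSpace ℝ (Fin 4)) = crossVec u s ∧
      A (circlePt (t₀ + s)) = E.jB 0 b) ∧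
    (∀ (θ : Metric.sphere (0 : EuclideanSpace ℝ (Fin 2)) 1) (b : ↥(beltPiece 3 1)),
      lamSq 1 (b.1.1 : EuclideanSpace ℝ (Fin 4)) = 0 → A θ = E.jB 0 b → θ = circlePt t₀) ∧
    (∀ (θ : Metric.sphere (0 : EuclideanSpace ℝ (Fin 2)) 1) (b : ↥(beltPiece 3 1)),
      lamSq 1 (b.1.1 : EuclideanSpace ℝ (Fin 4)) = 0 → A θ ≠ E.jB 1 b)
  /-- `qA` attaches along `A` with page twisting `−1` (a positive letter) -/
  qA_circle : qA.attachingCircle = A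
  qA_twist : pageTwisting (g + 1) A qA.attachingFraming = -1
  /-- `qA` IS THE STANDARD TUBE MAP (`TubeAttachData.attachingMap`, `HandleAttachingMapOfTube.lean`)
  of a FIBRED tube `Φ` around `A` (core `A`; first fibre coordinate inside the page, second = page
  angle, scale `σ`), with Kosinski's fibre coordinate twisted once around the core (sign `s`, the one
  giving page twisting `−1`): its values on the boundary torus `T ∩ ∂D⁴` are explicit — the input of
  the dual computation N3d-5 -/
  qA_tube : ∃ (Φ : Metric.sphere (0 : EuclideanSpace ℝ (Fin 2)) 1 × EuclideanSpace ℝ (Fin 2) → Base (g + 1))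
      (κ σ : ℝ) (s : Bool), 0 < κ ∧ σ ≠ 0 ∧
    ContMDiff ((𝓡 1).prod (𝓡 2)) (𝓡∂ 4) ∞ Φ ∧ InjOn Φ (univ ×ˢ Metric.ball 0 (2 * κ)) ∧
    (∀ x, Φ (x, 0) = A x) ∧
    (∀ x v, ‖v‖ < 2 * κ → Φ (x, v) ∈ page (g + 1) (pageDir (n + 4) 0 * Complex.exp ((σ * v 1 : ℝ) * Complex.I))) ∧
    (∀ (x : Metric.sphere (0 : EuclideanSpace ℝ (Fin 2)) 1) (v : EuclideanSpace ℝ (Fin 2)) (_ : ‖v‖ < 1)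
      (y : ↥(handleTube 3 2)),
      (y.1.1 : EuclideanSpace ℝ (Fin 4)) =
        WithLp.toLp 2 ![Real.sqrt (1 - ‖v‖ ^ 2) * x.1 0, Real.sqrt (1 - ‖v‖ ^ 2) * x.1 1, v 0, v 1] →
      qA.toFun y = Φ (x, κ • WithLp.toLp 2 ![x.1 0 * v 0 + (if s then 1 else -1) * x.1 1 * v 1,
        x.1 0 * v 1 - (if s then 1 else -1) * x.1 1 * v 0]))
  /-- the same for `B`: page `pageDir (n+4) 2`, class `b`, crossing the belt sphere of `1` once, missing `0` -/
  B_emb : Manifold.IsSmoothEmbedding (𝓡 1) (𝓡∂ 4) ∞ B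
  B_page : ∀ θ, B θ ∈ page (g + 1) (pageDir (n + 4) 2)
  B_shadow : shadow (g + 1) B B_emb.isEmbedding.continuous = newF g
  B_cross : ∃ (t₀ : ℝ) (u : EuclideanSpace ℝ (Fin 3)) (ε : ℝ), ‖u‖ = 1 ∧ 0 < ε ∧
    (∀ s ∈ Ioo (-ε) ε, ∃ b : ↥(beltPiece 3 1), (b.1.1 : EuclideanSpace ℝ (Fin 4)) = crossVec u s ∧
      B (circlePt (t₀ + s)) = E.jB 1 b) ∧
    (∀ (θ : Metric.sphere (0 : EuclideanSpace ℝ (Fin 2)) 1) (b : ↥(beltPiece 3 1)),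
      lamSq 1 (b.1.1 : EuclideanSpace ℝ (Fin 4)) = 0 → B θ = E.jB 1 b → θ = circlePt t₀) ∧
    (∀ (θ : Metric.sphere (0 : EuclideanSpace ℝ (Fin 2)) 1) (b : ↥(beltPiece 3 1)),
      lamSq 1 (b.1.1 : EuclideanSpace ℝ (Fin 4)) = 0 → B θ ≠ E.jB 0 b)
  qB_circle : qB.attachingCircle = B
  qB_twist : pageTwisting (g + 1) B qB.attachingFraming = -1
  /-- `qB` is the standard tube map of a fibred tube around `B` (as `qA_tube`, direction `pageDir (n+4) 2`) -/
  qB_tube : ∃ (Φ : Metric.sphere (0 : EuclideanSpace ℝ (Fin 2)) 1 × EuclideanSpace ℝ (Fin 2) → Base (g + 1))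
      (κ σ : ℝ) (s : Bool), 0 < κ ∧ σ ≠ 0 ∧
    ContMDiff ((𝓡 1).prod (𝓡 2)) (𝓡∂ 4) ∞ Φ ∧ InjOn Φ (univ ×ˢ Metric.ball 0 (2 * κ)) ∧
    (∀ x, Φ (x, 0) = B x) ∧
    (∀ x v, ‖v‖ < 2 * κ → Φ (x, v) ∈ page (g + 1) (pageDir (n + 4) 2 * Complex.exp ((σ * v 1 : ℝ) * Complex.I))) ∧
    (∀ (x : Metric.sphere (0 : EuclideanSpace ℝ (Fin 2)) 1) (v : EuclideanSpace ℝ (Fin 2)) (_ : ‖v‖ < 1)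
      (y : ↥(handleTube 3 2)),
      (y.1.1 : EuclideanSpace ℝ (Fin 4)) =
        WithLp.toLp 2 ![Real.sqrt (1 - ‖v‖ ^ 2) * x.1 0, Real.sqrt (1 - ‖v‖ ^ 2) * x.1 1, v 0, v 1] →
      qB.toFun y = Φ (x, κ • WithLp.toLp 2 ![x.1 0 * v 0 + (if s then 1 else -1) * x.1 1 * v 1,
        x.1 0 * v 1 - (if s then 1 else -1) * x.1 1 * v 0]))
  /-- the two block maps have disjoint ranges, inside the block part of the model region of the new base -/
  qAB_disjoint : Disjoint (range qA.toFun) (range qB.toFun)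
  range_qA : ∀ y, qA.toFun y ∈ modelRegion (g + 1) n δ₀ ε₁ ∧ w (g + 1) (qA.toFun y).1 ∈ blockSector n
  range_qB : ∀ y, qB.toFun y ∈ modelRegion (g + 1) n δ₀ ε₁ ∧ w (g + 1) (qB.toFun y).1 ∈ blockSector n

/-- **N3d-0 interface: a NORMALISED, RE-SPACED fibred datum of `M` adapted to the base data `S`**:
a fibred datum `(X, h, D, bX, Ψ)` of `(g, l)` glued into `M`, whose old handles sit in the pages of
directions `pageDir (n+4) (k+4)` (the positions they will have in the stabilised word) with the old
shadows and twistings and ranges OFF the block sector and INSIDE `‖x‖² < 4 − ε₁` (hence off every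
model region; shrink by locality, push the rims of the pages inward by a fibred squeeze), page-preserving
`Ψ`, and whose SEAM MAP `e = Ψ ∘ bX.incl⁻¹ ∘ D.jA` is the IDENTITY on the thickened binding tube
`‖x‖² > 4 − ε₁` of `∂Base g` (a solid torus around the binding containing the feet of the 1-handles
of `S`). [cite: EtnyreFuller2006, §2] -/
def NormalisedDatum (M : Type) [TopologicalSpace M] [ChartedSpace (EuclideanSpace ℝ (Fin 4)) M]
    (g : ℕ) (l : IntWord g) {c : Fin g ⊕ Fin g → ℤ} (S : StabBaseData g l.length c) : Prop :=
  ∃ (X : Type) (_ : TopologicalSpace X) (_ : T2Space X) (_ : SecondCountableTopology X)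
    (_ : CompactSpace X) (_ : ChartedSpace (EuclideanHalfSpace 4) X) (_ : IsManifold (𝓡∂ 4) ∞ X)
    (h : Fin l.length → HandleAttachingMap 3 2 (Base g)) (D : MultiAttachmentData h (𝓡∂ 4) X)
    (bX : BoundaryData (𝓡∂ 4) X (𝓡 3)) (Ψ : bX.carrier ≃ₘ⟮𝓡 3, 𝓡 3⟯ (bBase g).carrier),
    (∀ (i : Fin l.length) θ, (h i).attachingCircle θ ∈ page g (pageDir (l.length + 4) (i + 4))) ∧
    (∀ i, shadow g (h i).attachingCircle (h i).continuous_attachingCircle = (l.get i).1) ∧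
    (∀ i, pageTwisting g (h i).attachingCircle (h i).attachingFraming = if (l.get i).2 then -1 else 1) ∧
    (∀ i y, w g ((h i).toFun y).1 ∉ blockSector l.length ∧ ‖cx ((h i).toFun y).1‖ ^ 2 < 4 - S.ε₁) ∧
    IsBoundaryGluing bX (bBase g) Ψ (𝓡 4) M ∧
    (∀ (y : bX.carrier) (a : ↥(coresComplement h)), bX.incl y = D.jA a →
      ∃ r : ℝ, 0 < r ∧ w g ((bBase g).incl (Ψ y)).1 = (r : ℂ) * w g (a : Base g).1) ∧
    (∀ (y : bX.carrier) (a : ↥(coresComplement h)),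
      bX.incl y = D.jA a → 4 - S.ε₁ < ‖cx (a : Base g).1‖ ^ 2 → (bBase g).incl (Ψ y) = (a : Base g))

/-- **N3d-3 interface: THE TWO-SIDED STABILISED FIBRED MODEL of `M` over `Base (g+1)`** adapted to
`S` — the output of the rebase and the input of the trading: `M = X₁ ∪_ι W₂` (`IsBoundaryGluing`) with
`X₁` the multi-attachment over `Base (g+1)` of the family `Sum.elim ![S.qA, S.qB] hold` (the two
positive block handles at positions `0`, `2` and the old handles re-planted at positions `k + 4` with
shadows `embed` of the old classes, old twistings, ranges off the block sector), `W₂` the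
multi-attachment over `Base (g+1)` of two further maps `q'` (the cap-side cancelling 2-handles, traded
away later: no conditions), `ι` (i) direction-preserving from the `X₁`-seam to the `W₂`-seam, (ii) with
the seam/belt dichotomy backwards (a `W₂`-seam point comes from an `X₁`-seam point of the same direction
or from a deep belt point of an OLD handle, over that handle's direction), and (iii) THE MATCHING
CLAUSE: near the belts of the two block handles `ι` is the identity in Kosinski's model coordinates
(`D₁.jB (inl i) b ↦ D₂.jB i b`), so that trading `W₂`'s handles into `X₁` attaches the duals along
`X₁`'s own belt tubes of `qA`, `qB`. [cite: EtnyreFuller2006, §2] -/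
def TwoSidedStabModel (M : Type) [TopologicalSpace M] [ChartedSpace (EuclideanSpace ℝ (Fin 4)) M]
    (g : ℕ) (l : IntWord g) {c : Fin g ⊕ Fin g → ℤ} (S : StabBaseData g l.length c) : Prop :=
  ∃ (X₁ : Type) (_ : TopologicalSpace X₁) (_ : T2Space X₁) (_ : SecondCountableTopology X₁)
    (_ : CompactSpace X₁) (_ : ChartedSpace (EuclideanHalfSpace 4) X₁) (_ : IsManifold (𝓡∂ 4) ∞ X₁)
    (W₂ : Type) (_ : TopologicalSpace W₂) (_ : T2Space W₂) (_ : SecondCountableTopology W₂)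
    (_ : CompactSpace W₂) (_ : ChartedSpace (EuclideanHalfSpace 4) W₂) (_ : IsManifold (𝓡∂ 4) ∞ W₂)
    (hold : Fin l.length → HandleAttachingMap 3 2 (Base (g + 1)))
    (D₁ : MultiAttachmentData (Sum.elim ![S.qA, S.qB] hold) (𝓡∂ 4) X₁)
    (q' : Fin 2 → HandleAttachingMap 3 2 (Base (g + 1))) (D₂ : MultiAttachmentData q' (𝓡∂ 4) W₂)
    (b₁ : BoundaryData (𝓡∂ 4) X₁ (𝓡 3)) (b₂ : BoundaryData (𝓡∂ 4) W₂ (𝓡 3))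
    (ι : b₁.carrier ≃ₘ⟮𝓡 3, 𝓡 3⟯ b₂.carrier),
    (∀ (k : Fin l.length) θ, (hold k).attachingCircle θ ∈ page (g + 1) (pageDir (l.length + 4) (k + 4))) ∧
    (∀ k, shadow (g + 1) (hold k).attachingCircle (hold k).continuous_attachingCircle =
      embed g (l.get k).1) ∧
    (∀ k, pageTwisting (g + 1) (hold k).attachingCircle (hold k).attachingFraming =
      if (l.get k).2 then -1 else 1) ∧
    (∀ k y, w (g + 1) ((hold k).toFun y).1 ∉ blockSector l.length) ∧
    IsBoundaryGluing b₁ b₂ ι (𝓡 4) M ∧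
    (∀ (y : b₁.carrier) (a : ↥(coresComplement (Sum.elim ![S.qA, S.qB] hold))), b₁.incl y = D₁.jA a →
      ∃ (a' : ↥(coresComplement q')) (r : ℝ), 0 < r ∧ b₂.incl (ι y) = D₂.jA a' ∧
        w (g + 1) (a' : Base (g + 1)).1 = (r : ℂ) * w (g + 1) (a : Base (g + 1)).1) ∧
    (∀ (y : b₁.carrier) (a' : ↥(coresComplement q')), b₂.incl (ι y) = D₂.jA a' →
      (∃ (a : ↥(coresComplement (Sum.elim ![S.qA, S.qB] hold))) (r : ℝ), 0 < r ∧
          b₁.incl y = D₁.jA a ∧ w (g + 1) (a : Base (g + 1)).1 = (r : ℂ) * w (g + 1) (a' : Base (g + 1)).1) ∨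
      (∃ (k : Fin l.length) (b : ↥(beltPiece 3 2)) (r : ℝ), 0 < r ∧ b₁.incl y = D₁.jB (Sum.inr k) b ∧
          b₁.incl y ∉ range D₁.jA ∧ w (g + 1) (a' : Base (g + 1)).1 = (r : ℂ) * pageDir (l.length + 4) (k + 4))) ∧
    (∃ κ : ℝ, 0 < κ ∧ ∀ (i : Fin 2) (b : ↥(beltPiece 3 2)) (y : b₁.carrier),
      lamSq 2 (b.1.1 : EuclideanSpace ℝ (Fin 4)) < κ → b₁.incl y = D₁.jB (Sum.inl i) b →
        b₂.incl (ι y) = D₂.jB i b)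

/-! ## §3 First bookkeeping of the vocabulary (more in `…StabilisationAngles.lean`) -/

namespace StabilisationData

/-- `natWord g c l` is the explicit four-letter block followed by the embedded old word (so that the
def-free text of (ST-nat), `work/stubs/sig_node_STnat.txt`, is this statement with `natWord` unfolded).
[folklore] -/
theorem natWord_eq (g : ℕ) (c : Fin g ⊕ Fin g → ℤ) (l : IntWord g) :
    natWord g c l = (newE g + embed g c, true) :: (newE g + embed g c, false) :: (newF g, true) ::
      (newF g, false) :: mapWord (embed g) l := rfl

/-- Membership in the block sector, unfolded. [folklore] -/
theorem mem_blockSector_iff {n : ℕ} {z : ℂ} :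
    z ∈ blockSector n ↔ ∃ r t : ℝ, 0 < r ∧ t ∈ Ioo (-(17 / 4 : ℝ)) (1 / 4) ∧
      z = (r : ℂ) * Complex.exp ((2 * π * t / ((n + 4 : ℕ) : ℝ) : ℝ) * Complex.I) := Iff.rfl

/-- The block sector is a sector: positive real multiples of its points stay in it. [folklore] -/
theorem mul_mem_blockSector {n : ℕ} {z : ℂ} (hz : z ∈ blockSector n) {r : ℝ} (hr : 0 < r) :
    (r : ℂ) * z ∈ blockSector n := by
  obtain ⟨r', t, hr', ht, rfl⟩ := hz
  exact ⟨r * r', t, mul_pos hr hr', ht, by push_cast; ring⟩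

/-- **The four block directions lie in the block sector**: `pageDir (n+4) i`, `i < 4`, is the sector
point of radius `1` and parameter `t = −(i + ½) ∈ (−17/4, 1/4)`. [folklore] -/
theorem pageDir_mem_blockSector (n : ℕ) {i : ℕ} (hi : i < 4) : pageDir (n + 4) i ∈ blockSector n := by
  have hi3 : (i : ℝ) ≤ 3 := by exact_mod_cast Nat.lt_succ_iff.mp hi
  refine ⟨1, -(i + 1 / 2), one_pos, ⟨by linarith, by linarith [(Nat.cast_nonneg i : (0 : ℝ) ≤ i)]⟩, ?_⟩
  rw [pageDir, Complex.ofReal_one, one_mul]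
  congr 2
  push_cast
  ring

/-- Half of a block direction (the value of `w` on the flat page of that direction) lies in the
block sector. [folklore] -/
theorem pageDir_div_two_mem_blockSector (n : ℕ) {i : ℕ} (hi : i < 4) :
    pageDir (n + 4) i / 2 ∈ blockSector n := by
  have h := mul_mem_blockSector (pageDir_mem_blockSector n hi) (r := 1 / 2) (by norm_num)
  convert h using 1
  push_cast
  ring

/-- Membership in the model region, unfolded. [folklore] -/
theorem mem_modelRegion_iff {g n : ℕ} {δ₀ ε₁ : ℝ} {p : Base g} :
    p ∈ modelRegion g n δ₀ ε₁ ↔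
      1 / 4 - δ₀ < rho g p.1 ∧ (4 - ε₁ < ‖cx p.1‖ ^ 2 ∨ w g p.1 ∈ blockSector n) := Iff.rfl

/-- **Points over directions off the block sector and inside `‖x‖² ≤ 4 − ε₁` are off the model
region** — where N3d-0 puts the old handles, so that the cancellation of N3d-2 fixes them. [folklore] -/
theorem not_mem_modelRegion {g n : ℕ} {δ₀ ε₁ : ℝ} {p : Base g} (hw : w g p.1 ∉ blockSector n)
    (hx : ‖cx p.1‖ ^ 2 ≤ 4 - ε₁) : p ∉ modelRegion g n δ₀ ε₁ := fun h =>
  h.2.elim (fun h' => (not_lt.2 hx) h') hw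

/-- Points of the model region lie in the collar `rho > 1/4 − δ₀`. [folklore] -/
theorem rho_gt_of_mem_modelRegion {g n : ℕ} {δ₀ ε₁ : ℝ} {p : Base g} (h : p ∈ modelRegion g n δ₀ ε₁) :
    1 / 4 - δ₀ < rho g p.1 := h.1

/-- A point of a flat page whose direction is in the block sector, at depth less than `δ₀`, lies in
the model region (where the block handles of `StabBaseData` attach). [folklore] -/
theorem mem_modelRegion_of_mem_page {g n : ℕ} {δ₀ ε₁ : ℝ} (hδ₀ : 0 < δ₀) {d : ℂ} (hd : ‖d‖ = 1)
    (hdn : d ∈ blockSector n) {p : Base g} (hp : p ∈ page g d) : p ∈ modelRegion g n δ₀ ε₁ := by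
  refine ⟨by rw [rho_eq_of_mem_page g hd hp]; linarith, Or.inr ?_⟩
  rw [hp.2, div_eq_mul_inv, mul_comm]
  have h := mul_mem_blockSector hdn (r := 2⁻¹) (by norm_num)
  convert h using 2
  push_cast
  ring

end StabilisationData

/-! ## Registered helper -/

/-- **Registered helper `helper_pageDir_mem_blockSector` (sub-goal of `stub_STgeo` ▸ N3-nat ▸ the
stabilisation data, wave 7, lead c5): the four block directions `pageDir (n+4) i`, `i < 4`, of the
stabilised word lie in the block sector `blockSector n` of the model region.** [folklore] -/
theorem helper_pageDir_mem_blockSector : ∀ (n i : ℕ), i < 4 → Literature.Topology.FourManifolds.LefschetzBase.pageDir (n + 4) i ∈ Summit.SmoothPoincare4.SmoothPoincare4.Theorems.AcyclicBisectionExists.ModpBraidOrbits.blockSector n :=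
  fun n _ hi => StabilisationData.pageDir_mem_blockSector n hi

end Summit.SmoothPoincare4.SmoothPoincare4.Theorems.AcyclicBisectionExists.ModpBraidOrbits

end
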